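import Summits.BirchSwinnertonDyer.BirchSwinnertonDyer.Theorems.KimAtThreePortSharedC2Supply
import Summits.BirchSwinnertonDyer.BirchSwinnertonDyer.Theorems.KimAtThreeShallowEqDeepResidualSeam
import HarnessLib

/-!
# The W2 route's RESIDUAL keyed on the FINE KATO PACKAGE (C1): the Kato-stratum alias, the three
# cruxes and the leaf `N11.KimAtThreeRankZeroPUB` from four PUBLISHED inputs by name + (C1) + (C3) +
# the off-stratum children — the 19076-resplit glue package of crux 19560's owner
# (cell `bsd-addord`, seat kim3 gen 11; route W2 `KimAtThreeKolyvagin`, item stmt-BirchSwinnertonDyer-19560)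

STATE OF RECORD (planner TARGET v6.39 E120 (i)): crux 19560 `KatoKuriharaPortThreeShared` (PORT″ on
the Kato stratum) ⟸ **(C1) FINE KATO PACKAGE** (kim3 line; Kato's `ZetaBody` family for the optimal
newform WITH the finite-level dual-exponential riders `KatoExpStarFiniteLevelAt` and the
`ω`-normalisation of Kato's constant — construction-shaped over the tree until `exp*`/`D_dR` exist,
n1011 ROUTE-1 §53.4 D-53-6) + **(C3) ANOMALOUS ROWS** (rows with a bad `w ≠ 3` carrying a non-zero
`3`-torsion point over `ℚ_w`; kernel road D7-u = [MR04] Remark A.5 in flight: n1011-p15 T-DER-BU,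
w2-c3 g5 / w2-tamdiv / acc5), by w2-c3 g4's `katoKuriharaPortThreeShared_of_fineKato_of_anomalousRows`
(p457409; (C2′) is a theorem class-wide, p456153).  The planner (STATUS 2026-08-26T18:05:24Z (a))
asks 19560's owner for the RESPLIT PACKAGE of the parent 19076: child texts elaborated against the
route file + a sorry-free glue.  THIS FILE is that package:
* `katoStratumSharedParts_of_pub_of_fineKato_of_anomalousRows` — the five-part alias (item 19678)
  from the four PUBLISHED leaves BY NAME (Sakamoto 2024 Thm. 4.4 pair, Gross–Zagier–Kolyvagin,
  Poitou–Tate, Carayol) + (C1) + (C3);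
* `deepUpperAtThree_…`, `deepLowerAtThree_…`, `shallowEqDeepAtTorsionFree_…_of_off` — the three
  cruxes 19076 / 19075 / 19077 from the same + their off-stratum child (19562 / 19679 / 19599), via
  w2-c4's no-stub seams (p445255; the stub child 19561 is NOT an input) and glue 19680 — i.e. the
  glue `DeepUpperAtThreeOfParts` RE-KEYED with `KatoKuriharaPortThreeShared` ↦ {(C1), (C3)};
* `kimAtThreeRankZeroPUB_of_pub_of_fineKato_of_anomalousRows_of_deepUpperOff_of_residualOff` — THE
  ROUTE'S RESIDUAL IN ONE KERNEL THEOREM: the leaf from the four PUB leaves + (C1) + (C3) + crux 19562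
  + w2-c4 g6's displayed off-stratum residual (R)_off (p463239), for the 2026-08-28 declaration;
* `fineKato_projection` — HONESTY LEMMA: (C1) is the conclusion of the PUBLISHED named fact
  `Kato2004.exists_eulerSystem_expStar_values` STRENGTHENED by exactly n1011's (P-EXP) rider + R-κ.
(C1)/(C3) are displayed VERBATIM as in p448445 / p457409.  When the D7-u END lands
(`… : C1 → KatoKuriharaPortThreeShared`), each `hC3` is discharged by one line and the Kato-stratum
residual is (C1) ALONE.  HONEST LIMITS: theorems only (0 defs, 0 facts, 0 sorry); closes nothing by
itself (19560 / 19075 / 19076 / 19077 stay OPEN); nothing booked; BSD is not proved by any of this.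
References: kim3 memos `HOME/kim3/KIM3-W2-PORT-g10.md`, `KIM3-W2-C1-g11.md`; [Kato2004Asterisque]
(8.1.3), Prop. 8.12, §9.4, Thm. 9.7, Thm. 6.6 (1), Ex. 13.3; [Kim2022StructureSelmer] Thm. 3.13,
§3.3–3.4.1; [MazurRubin2004] Thm. 3.2.4, App. A; [Sakamoto2024] Thm. 4.4; [Kim2025RefinedTNC]
Thm. 1.1/1.2 (the announced statement; never an input).
-/

noncomputable section

-- the cell's Theorems namespace repeats the summit name by design (D-0017)
set_option linter.dupNamespace false
set_option autoImplicit false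

open scoped NumberField TensorProduct Classical
open Field Finset IsDedekindDomain NumberField WeierstrassCurve Rat.HeightOneSpectrum CongruenceSubgroup
open Literature.NumberTheory.GaloisRepresentations Literature.NumberTheory.GaloisCohomology
open Literature.NumberTheory.GaloisRepresentations.DiscreteGaloisModule
open Literature.NumberTheory.EllipticCurves Literature.NumberTheory.EllipticCurves.ModularForms
open Literature.NumberTheory.EllipticCurves.Rank1Residual
open Literature.NumberTheory.EllipticCurves.Kato2004
open Literature.NumberTheory.EllipticCurves.Kato2004.EulerSystemValues
open Summit.BirchSwinnertonDyer.Rank1Residual.GaloisImage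
open Summit.BirchSwinnertonDyer.Rank1Residual.Additive
open Summit.BirchSwinnertonDyer.BirchSwinnertonDyer.Theses.KimAtThreeKolyvagin
open Summit.BirchSwinnertonDyer.BirchSwinnertonDyer.Theorems

namespace Summit.BirchSwinnertonDyer.BirchSwinnertonDyer.Theorems.KimAtThreeDeepUpperSplitGlueFineKato

/-! ### §0. Honesty lemma: (C1) projects onto the conclusion of Kato's PUBLISHED fact -/
/-- **(C1) is the cited fact's conclusion STRENGTHENED by exactly the (P-EXP) rider + R-κ**: at any
row the FINE KATO PACKAGE implies the bare conclusion shape of `Kato2004.exists_eulerSystem_expStar_values`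
for that newform (`∃ κ ≠ 0, ∃ Λ, ∀ c d a A …, ∃ z x, ZetaBody …`) — forget `Λfin`, the riders and the
normalisation (kim3 memo Lemma L/L′, n1011 LEMMA SAT, (a″) are what (C1) adds to print).
[cite: Kato2004Asterisque, (8.1.3) (p. 180), Prop. 8.12 (p. 186), §9.4 and Thm. 9.7 (pp. 188–189), Thm. 6.6 (1) (p. 163), Ex. 13.3 (pp. 224–225)]
[cite: Kim2022StructureSelmer, §3.3 (Lemma 3.11, Prop. 3.12) and §3.4.1] -/
theorem fineKato_projection (W : WeierstrassCurve ℚ) [W.IsElliptic]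
    [ContinuousSMul ℤ_[3] (W.tateModule 3)] [Module.Free ℤ_[3] (W.tateModule 3)]
    [Module.Finite ℤ_[3] (W.tateModule 3)]
    (v₃ : HeightOneSpectrum (𝓞 ℚ)) {N : ℕ} [NeZero N] (f : CuspForm (Gamma0 N) 2)
    (h : ∃ (ι : (n : ℕ) → (CyclotomicField n ℚ →+* ℂ)) (κK : ℝ)
          (Λ : ∀ (k' : ℕ) (r : Finset (HeightOneSpectrum (𝓞 ℚ))),
            H1 (tateRep W 3) (cycSubgroup 3 k' r) →ₗ[ℤ_[3]]
              ℚ_[3] ⊗[ℚ] CyclotomicField (cycLevel 3 k' r) ℚ)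
          (Λfin : ∀ j : ℕ, galoisCohomology
            ((W.torsionGaloisModule (((3 : ℕ) : ℤ) ^ j * ((3 : ℕ) : ℤ))).toLocal (Sum.inr v₃)) 1 →+
              ZMod (3 ^ (j + 1))),
          κK ≠ 0 ∧ (∃ u : ℚ, (u : ℝ) = κK ∧ padicValRat 3 u = 0) ∧
          (∀ j : ℕ, KatoExpStarFiniteLevelAt W 3 j 0 v₃ Λ (Λfin j)) ∧
          ∀ (c d a : ℤ) (A : ℕ), 0 < A → Int.gcd c (6 * 3 * A) = 1 → Int.gcd d (6 * 3 * N) = 1 →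
            ∃ (z : ∀ (k' : ℕ) (r : (cyclotomicLevelsRat 3 (badPlaces c d A N)).Ideals),
                  H1 (tateRep W 3) ((cyclotomicLevelsRat 3 (badPlaces c d A N)).level k' r.1))
              (x : ∀ (k' : ℕ) (r : (cyclotomicLevelsRat 3 (badPlaces c d A N)).Ideals),
                  CyclotomicField (cycLevel 3 k' r.1) ℚ),
              ZetaBody W 3 f ι κK Λ c d a A z x) :
    ∃ (ι : (n : ℕ) → (CyclotomicField n ℚ →+* ℂ)) (κK : ℝ), κK ≠ 0 ∧
      ∃ Λ : ∀ (k' : ℕ) (r : Finset (HeightOneSpectrum (𝓞 ℚ))),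
          H1 (tateRep W 3) (cycSubgroup 3 k' r) →ₗ[ℤ_[3]] ℚ_[3] ⊗[ℚ] CyclotomicField (cycLevel 3 k' r) ℚ,
        ∀ (c d a : ℤ) (A : ℕ), 0 < A → Int.gcd c (6 * 3 * A) = 1 → Int.gcd d (6 * 3 * N) = 1 →
          ∃ (z : ∀ (k' : ℕ) (r : (cyclotomicLevelsRat 3 (badPlaces c d A N)).Ideals),
                H1 (tateRep W 3) ((cyclotomicLevelsRat 3 (badPlaces c d A N)).level k' r.1))
            (x : ∀ (k' : ℕ) (r : (cyclotomicLevelsRat 3 (badPlaces c d A N)).Ideals),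
                CyclotomicField (cycLevel 3 k' r.1) ℚ),
            ZetaBody W 3 f ι κK Λ c d a A z x := by
  obtain ⟨ι, κK, Λ, -, hκ, -, -, hz⟩ := h
  exact ⟨ι, κK, hκ, Λ, hz⟩

/-! ### §1. The five-part Kato-stratum alias `KatoStratumSharedParts` (item 19678) keyed on (C1) + (C3) -/

/-- **`KatoStratumSharedParts` (item 19678) from four PUBLISHED inputs BY NAME + (C1) + (C3).**
Conjuncts 1–4 are the cite-only leaves (Sakamoto 2024 Thm. 4.4 and its Fitting clause at `p = 3`;
Gross–Zagier–Kolyvagin; Poitou–Tate duality for Selmer structures over `ℚ`; Carayol's level =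
conductor); conjunct 5 = crux 19560 `KatoKuriharaPortThreeShared` is supplied by w2-c3 g4's
`katoKuriharaPortThreeShared_of_fineKato_of_anomalousRows` (p457409) from the FINE KATO PACKAGE (C1)
and the ANOMALOUS ROWS (C3), both displayed VERBATIM (texts of p448445).  Nothing is booked.
[cite: Sakamoto2024, Thm. 4.4 (p. 926)] [cite: Kato2004Asterisque, (8.1.3) (p. 180), Prop. 8.12 (p. 186), Thm. 9.7 (p. 189), Thm. 6.6 (1) (p. 163), Ex. 13.3 (pp. 224–225)]
[cite: Kim2022StructureSelmer, Thm. 3.13 and §3.3–§3.4.1] [cite: MazurRubin2004, Thm. 3.2.4 and App. A Remark A.5] -/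
theorem katoStratumSharedParts_of_pub_of_fineKato_of_anomalousRows
    (hSak : SakamotoKolyvaginThree) (hGZK : RankEqAnalyticRankLeOne)
    (hPT : PoitouTateSelmerDuality) (hlev : CarayolLevelEqConductor)
    (hC1 : ∀ (W : WeierstrassCurve ℚ) [W.IsElliptic] [W.IsGloballyMinimal]
      [ContinuousSMul ℤ_[3] (W.tateModule 3)] [Module.Free ℤ_[3] (W.tateModule 3)]
      [Module.Finite ℤ_[3] (W.tateModule 3)],
      (∀ m : ℕ, W.HasSurjectiveModNGaloisRep (3 ^ m : ℕ)) →
      (haveI : Fact (Nat.Prime 3) := ⟨Nat.prime_three⟩; Addv W 3) →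
      ¬ 3 ∣ (W.baseChange ℚ_[3]).localTamagawaNumber ℤ_[3] →
      Nat.card {Q : (W.baseChange ℚ_[3]).toAffine.Point // (3 : ℕ) • Q = 0} = 1 →
      ∀ (v₃ : HeightOneSpectrum (𝓞 ℚ)), ((3 : ℕ) : 𝓞 ℚ) ∈ v₃.asIdeal →
      ∀ {N : ℕ} [NeZero N] (P : ModularParametrizationData W N), N = W.conductorNorm ℤ →
        (∀ z ∈ P.L.lattice, ∃ w ∈ periodLattice P.f, z = P.c * w) →
        ¬ (3 : ℤ) ∣ P.maninConstant →
        ∃ (ι : (n : ℕ) → (CyclotomicField n ℚ →+* ℂ)) (κK : ℝ)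
          (Λ : ∀ (k' : ℕ) (r : Finset (HeightOneSpectrum (𝓞 ℚ))),
            H1 (tateRep W 3) (cycSubgroup 3 k' r) →ₗ[ℤ_[3]]
              ℚ_[3] ⊗[ℚ] CyclotomicField (cycLevel 3 k' r) ℚ)
          (Λfin : ∀ j : ℕ, galoisCohomology
            ((W.torsionGaloisModule (((3 : ℕ) : ℤ) ^ j * ((3 : ℕ) : ℤ))).toLocal (Sum.inr v₃)) 1 →+
              ZMod (3 ^ (j + 1))),
          κK ≠ 0 ∧ (∃ u : ℚ, (u : ℝ) = κK ∧ padicValRat 3 u = 0) ∧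
          (∀ j : ℕ, KatoExpStarFiniteLevelAt W 3 j 0 v₃ Λ (Λfin j)) ∧
          ∀ (c d a : ℤ) (A : ℕ), 0 < A → Int.gcd c (6 * 3 * A) = 1 → Int.gcd d (6 * 3 * N) = 1 →
            ∃ (z : ∀ (k' : ℕ) (r : (cyclotomicLevelsRat 3 (badPlaces c d A N)).Ideals),
                  H1 (tateRep W 3) ((cyclotomicLevelsRat 3 (badPlaces c d A N)).level k' r.1))
              (x : ∀ (k' : ℕ) (r : (cyclotomicLevelsRat 3 (badPlaces c d A N)).Ideals),
                  CyclotomicField (cycLevel 3 k' r.1) ℚ),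
              ZetaBody W 3 P.f ι κK Λ c d a A z x)
    (hC3 : ∀ (W : WeierstrassCurve ℚ) [W.IsElliptic] [W.IsGloballyMinimal],
      (∀ m : ℕ, W.HasSurjectiveModNGaloisRep (3 ^ m : ℕ)) →
      (haveI : Fact (Nat.Prime 3) := ⟨Nat.prime_three⟩; Addv W 3) →
      ¬ 3 ∣ (W.baseChange ℚ_[3]).localTamagawaNumber ℤ_[3] →
      Nat.card {Q : (W.baseChange ℚ_[3]).toAffine.Point // (3 : ℕ) • Q = 0} = 1 →
      ∀ (v₃ : HeightOneSpectrum (𝓞 ℚ)), ((3 : ℕ) : 𝓞 ℚ) ∈ v₃.asIdeal →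
      ∀ (η : (q : HeightOneSpectrum (𝓞 ℚ)) → (ZMod (Ideal.absNorm q.asIdeal))ˣ),
        (∀ q, Subgroup.zpowers (η q) = ⊤) →
      ∀ {N : ℕ} [NeZero N] (P : ModularParametrizationData W N), N = W.conductorNorm ℤ →
        (∀ z ∈ P.L.lattice, ∃ w ∈ periodLattice P.f, z = P.c * w) →
        ¬ (3 : ℤ) ∣ P.maninConstant →
        (∃ w : HeightOneSpectrum (𝓞 ℚ), ¬ W.HasGoodReductionAt w ∧
          ((primesEquiv w : Nat.Primes) : ℕ) ≠ 3 ∧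
          ∃ Q : (W.baseChange (w.adicCompletion ℚ)).toAffine.Point, 3 • Q = 0 ∧ Q ≠ 0) →
        KatoKuriharaPortThreeAtWith₂ W 0 v₃ η P) :
    KatoStratumSharedParts :=
  ⟨hSak, hGZK, hPT, hlev,
    KimAtThreePortSharedC2Supply.katoKuriharaPortThreeShared_of_fineKato_of_anomalousRows hC1 hC3⟩

/-! ### §2. The three cruxes re-keyed: PUB leaves + (C1) + (C3) + the off-stratum child -/

/-- **Crux 19076 `DeepUpperAtThree` from four PUBLISHED inputs + (C1) + (C3) + crux 19562
`DeepUpperAtThreeOffKatoStratum`** — the glue `DeepUpperAtThreeOfParts` RE-KEYED with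
`KatoKuriharaPortThreeShared` ↦ {(C1), (C3)} and WITHOUT the stub child 19561 (w2-c4's no-stub seam,
p445255); resplit shape `DeepUpperAtThree --into <C1> <C3> <19558 19921 19559 19467 19562>`.
[cite: Kim2025RefinedTNC, Thm. 1.1] [cite: Sakamoto2024, Thm. 4.4 (p. 926)] [cite: MazurRubin2004, Thm. 4.4.1 and Thm. 5.2.12] -/
theorem deepUpperAtThree_of_pub_of_fineKato_of_anomalousRows_of_off
    (hSak : SakamotoKolyvaginThree) (hGZK : RankEqAnalyticRankLeOne)
    (hPT : PoitouTateSelmerDuality) (hlev : CarayolLevelEqConductor)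
    (hC1 : ∀ (W : WeierstrassCurve ℚ) [W.IsElliptic] [W.IsGloballyMinimal]
      [ContinuousSMul ℤ_[3] (W.tateModule 3)] [Module.Free ℤ_[3] (W.tateModule 3)]
      [Module.Finite ℤ_[3] (W.tateModule 3)],
      (∀ m : ℕ, W.HasSurjectiveModNGaloisRep (3 ^ m : ℕ)) →
      (haveI : Fact (Nat.Prime 3) := ⟨Nat.prime_three⟩; Addv W 3) →
      ¬ 3 ∣ (W.baseChange ℚ_[3]).localTamagawaNumber ℤ_[3] →
      Nat.card {Q : (W.baseChange ℚ_[3]).toAffine.Point // (3 : ℕ) • Q = 0} = 1 →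
      ∀ (v₃ : HeightOneSpectrum (𝓞 ℚ)), ((3 : ℕ) : 𝓞 ℚ) ∈ v₃.asIdeal →
      ∀ {N : ℕ} [NeZero N] (P : ModularParametrizationData W N), N = W.conductorNorm ℤ →
        (∀ z ∈ P.L.lattice, ∃ w ∈ periodLattice P.f, z = P.c * w) →
        ¬ (3 : ℤ) ∣ P.maninConstant →
        ∃ (ι : (n : ℕ) → (CyclotomicField n ℚ →+* ℂ)) (κK : ℝ)
          (Λ : ∀ (k' : ℕ) (r : Finset (HeightOneSpectrum (𝓞 ℚ))),
            H1 (tateRep W 3) (cycSubgroup 3 k' r) →ₗ[ℤ_[3]]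
              ℚ_[3] ⊗[ℚ] CyclotomicField (cycLevel 3 k' r) ℚ)
          (Λfin : ∀ j : ℕ, galoisCohomology
            ((W.torsionGaloisModule (((3 : ℕ) : ℤ) ^ j * ((3 : ℕ) : ℤ))).toLocal (Sum.inr v₃)) 1 →+
              ZMod (3 ^ (j + 1))),
          κK ≠ 0 ∧ (∃ u : ℚ, (u : ℝ) = κK ∧ padicValRat 3 u = 0) ∧
          (∀ j : ℕ, KatoExpStarFiniteLevelAt W 3 j 0 v₃ Λ (Λfin j)) ∧
          ∀ (c d a : ℤ) (A : ℕ), 0 < A → Int.gcd c (6 * 3 * A) = 1 → Int.gcd d (6 * 3 * N) = 1 →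
            ∃ (z : ∀ (k' : ℕ) (r : (cyclotomicLevelsRat 3 (badPlaces c d A N)).Ideals),
                  H1 (tateRep W 3) ((cyclotomicLevelsRat 3 (badPlaces c d A N)).level k' r.1))
              (x : ∀ (k' : ℕ) (r : (cyclotomicLevelsRat 3 (badPlaces c d A N)).Ideals),
                  CyclotomicField (cycLevel 3 k' r.1) ℚ),
              ZetaBody W 3 P.f ι κK Λ c d a A z x)
    (hC3 : ∀ (W : WeierstrassCurve ℚ) [W.IsElliptic] [W.IsGloballyMinimal],
      (∀ m : ℕ, W.HasSurjectiveModNGaloisRep (3 ^ m : ℕ)) →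
      (haveI : Fact (Nat.Prime 3) := ⟨Nat.prime_three⟩; Addv W 3) →
      ¬ 3 ∣ (W.baseChange ℚ_[3]).localTamagawaNumber ℤ_[3] →
      Nat.card {Q : (W.baseChange ℚ_[3]).toAffine.Point // (3 : ℕ) • Q = 0} = 1 →
      ∀ (v₃ : HeightOneSpectrum (𝓞 ℚ)), ((3 : ℕ) : 𝓞 ℚ) ∈ v₃.asIdeal →
      ∀ (η : (q : HeightOneSpectrum (𝓞 ℚ)) → (ZMod (Ideal.absNorm q.asIdeal))ˣ),
        (∀ q, Subgroup.zpowers (η q) = ⊤) →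
      ∀ {N : ℕ} [NeZero N] (P : ModularParametrizationData W N), N = W.conductorNorm ℤ →
        (∀ z ∈ P.L.lattice, ∃ w ∈ periodLattice P.f, z = P.c * w) →
        ¬ (3 : ℤ) ∣ P.maninConstant →
        (∃ w : HeightOneSpectrum (𝓞 ℚ), ¬ W.HasGoodReductionAt w ∧
          ((primesEquiv w : Nat.Primes) : ℕ) ≠ 3 ∧
          ∃ Q : (W.baseChange (w.adicCompletion ℚ)).toAffine.Point, 3 • Q = 0 ∧ Q ≠ 0) →
        KatoKuriharaPortThreeAtWith₂ W 0 v₃ η P)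
    (hOff : DeepUpperAtThreeOffKatoStratum) :
    DeepUpperAtThree :=
  KimAtThreeDeepLowerSplitGlueItem.deepUpperAtThree_of_katoStratumSharedParts
    (katoStratumSharedParts_of_pub_of_fineKato_of_anomalousRows hSak hGZK hPT hlev hC1 hC3) hOff

/-- **Crux 19075 `DeepLowerAtThree` from four PUBLISHED inputs + (C1) + (C3) + crux 19679
`DeepLowerAtThreeOffKatoStratum`** (glue item 19680 `DeepLowerOfParts`, PROVED — w2-c2's
`deepLowerOfParts_proof` — fed with the alias of §1).  Nothing is booked.
[cite: Kim2025RefinedTNC, Thm. 1.1] [cite: Sakamoto2024, Thm. 4.4 (p. 926)] [cite: MazurRubin2004, Thm. 5.2.12]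
[cite: Kato2004Asterisque, (8.1.3) (p. 180), Thm. 9.7 (p. 189), Thm. 6.6 (1) (p. 163)] -/
theorem deepLowerAtThree_of_pub_of_fineKato_of_anomalousRows_of_off
    (hSak : SakamotoKolyvaginThree) (hGZK : RankEqAnalyticRankLeOne)
    (hPT : PoitouTateSelmerDuality) (hlev : CarayolLevelEqConductor)
    (hC1 : ∀ (W : WeierstrassCurve ℚ) [W.IsElliptic] [W.IsGloballyMinimal]
      [ContinuousSMul ℤ_[3] (W.tateModule 3)] [Module.Free ℤ_[3] (W.tateModule 3)]
      [Module.Finite ℤ_[3] (W.tateModule 3)],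
      (∀ m : ℕ, W.HasSurjectiveModNGaloisRep (3 ^ m : ℕ)) →
      (haveI : Fact (Nat.Prime 3) := ⟨Nat.prime_three⟩; Addv W 3) →
      ¬ 3 ∣ (W.baseChange ℚ_[3]).localTamagawaNumber ℤ_[3] →
      Nat.card {Q : (W.baseChange ℚ_[3]).toAffine.Point // (3 : ℕ) • Q = 0} = 1 →
      ∀ (v₃ : HeightOneSpectrum (𝓞 ℚ)), ((3 : ℕ) : 𝓞 ℚ) ∈ v₃.asIdeal →
      ∀ {N : ℕ} [NeZero N] (P : ModularParametrizationData W N), N = W.conductorNorm ℤ →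
        (∀ z ∈ P.L.lattice, ∃ w ∈ periodLattice P.f, z = P.c * w) →
        ¬ (3 : ℤ) ∣ P.maninConstant →
        ∃ (ι : (n : ℕ) → (CyclotomicField n ℚ →+* ℂ)) (κK : ℝ)
          (Λ : ∀ (k' : ℕ) (r : Finset (HeightOneSpectrum (𝓞 ℚ))),
            H1 (tateRep W 3) (cycSubgroup 3 k' r) →ₗ[ℤ_[3]]
              ℚ_[3] ⊗[ℚ] CyclotomicField (cycLevel 3 k' r) ℚ)
          (Λfin : ∀ j : ℕ, galoisCohomology
            ((W.torsionGaloisModule (((3 : ℕ) : ℤ) ^ j * ((3 : ℕ) : ℤ))).toLocal (Sum.inr v₃)) 1 →+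
              ZMod (3 ^ (j + 1))),
          κK ≠ 0 ∧ (∃ u : ℚ, (u : ℝ) = κK ∧ padicValRat 3 u = 0) ∧
          (∀ j : ℕ, KatoExpStarFiniteLevelAt W 3 j 0 v₃ Λ (Λfin j)) ∧
          ∀ (c d a : ℤ) (A : ℕ), 0 < A → Int.gcd c (6 * 3 * A) = 1 → Int.gcd d (6 * 3 * N) = 1 →
            ∃ (z : ∀ (k' : ℕ) (r : (cyclotomicLevelsRat 3 (badPlaces c d A N)).Ideals),
                  H1 (tateRep W 3) ((cyclotomicLevelsRat 3 (badPlaces c d A N)).level k' r.1))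
              (x : ∀ (k' : ℕ) (r : (cyclotomicLevelsRat 3 (badPlaces c d A N)).Ideals),
                  CyclotomicField (cycLevel 3 k' r.1) ℚ),
              ZetaBody W 3 P.f ι κK Λ c d a A z x)
    (hC3 : ∀ (W : WeierstrassCurve ℚ) [W.IsElliptic] [W.IsGloballyMinimal],
      (∀ m : ℕ, W.HasSurjectiveModNGaloisRep (3 ^ m : ℕ)) →
      (haveI : Fact (Nat.Prime 3) := ⟨Nat.prime_three⟩; Addv W 3) →
      ¬ 3 ∣ (W.baseChange ℚ_[3]).localTamagawaNumber ℤ_[3] →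
      Nat.card {Q : (W.baseChange ℚ_[3]).toAffine.Point // (3 : ℕ) • Q = 0} = 1 →
      ∀ (v₃ : HeightOneSpectrum (𝓞 ℚ)), ((3 : ℕ) : 𝓞 ℚ) ∈ v₃.asIdeal →
      ∀ (η : (q : HeightOneSpectrum (𝓞 ℚ)) → (ZMod (Ideal.absNorm q.asIdeal))ˣ),
        (∀ q, Subgroup.zpowers (η q) = ⊤) →
      ∀ {N : ℕ} [NeZero N] (P : ModularParametrizationData W N), N = W.conductorNorm ℤ →
        (∀ z ∈ P.L.lattice, ∃ w ∈ periodLattice P.f, z = P.c * w) →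
        ¬ (3 : ℤ) ∣ P.maninConstant →
        (∃ w : HeightOneSpectrum (𝓞 ℚ), ¬ W.HasGoodReductionAt w ∧
          ((primesEquiv w : Nat.Primes) : ℕ) ≠ 3 ∧
          ∃ Q : (W.baseChange (w.adicCompletion ℚ)).toAffine.Point, 3 • Q = 0 ∧ Q ≠ 0) →
        KatoKuriharaPortThreeAtWith₂ W 0 v₃ η P)
    (hOff : DeepLowerAtThreeOffKatoStratum) :
    DeepLowerAtThree :=
  KimAtThreeDeepLowerSplitGlueItem.deepLowerOfParts_proof
    (katoStratumSharedParts_of_pub_of_fineKato_of_anomalousRows hSak hGZK hPT hlev hC1 hC3) hOff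

/-- **Crux 19077 `ShallowEqDeepAtTorsionFree` from four PUBLISHED inputs + (C1) + (C3) + crux 19599
`ShallowEqDeepOffKatoStratum`** (w2-c4's no-stub seam `shallowEqDeepAtTorsionFree_of_parts_noStub`,
p445255, via `shallowEqDeepAtTorsionFree_of_katoStratumSharedParts`).  Nothing is booked.
[cite: Kim2025RefinedTNC, Thm. 1.1] [cite: Sakamoto2024, Thm. 4.4 (p. 926)] [cite: Kim2022StructureSelmer, Thm. 1.9]
[cite: Kato2004Asterisque, (8.1.3) (p. 180), Thm. 9.7 (p. 189), Thm. 6.6 (1) (p. 163)] -/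
theorem shallowEqDeepAtTorsionFree_of_pub_of_fineKato_of_anomalousRows_of_off
    (hSak : SakamotoKolyvaginThree) (hGZK : RankEqAnalyticRankLeOne)
    (hPT : PoitouTateSelmerDuality) (hlev : CarayolLevelEqConductor)
    (hC1 : ∀ (W : WeierstrassCurve ℚ) [W.IsElliptic] [W.IsGloballyMinimal]
      [ContinuousSMul ℤ_[3] (W.tateModule 3)] [Module.Free ℤ_[3] (W.tateModule 3)]
      [Module.Finite ℤ_[3] (W.tateModule 3)],
      (∀ m : ℕ, W.HasSurjectiveModNGaloisRep (3 ^ m : ℕ)) →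
      (haveI : Fact (Nat.Prime 3) := ⟨Nat.prime_three⟩; Addv W 3) →
      ¬ 3 ∣ (W.baseChange ℚ_[3]).localTamagawaNumber ℤ_[3] →
      Nat.card {Q : (W.baseChange ℚ_[3]).toAffine.Point // (3 : ℕ) • Q = 0} = 1 →
      ∀ (v₃ : HeightOneSpectrum (𝓞 ℚ)), ((3 : ℕ) : 𝓞 ℚ) ∈ v₃.asIdeal →
      ∀ {N : ℕ} [NeZero N] (P : ModularParametrizationData W N), N = W.conductorNorm ℤ →
        (∀ z ∈ P.L.lattice, ∃ w ∈ periodLattice P.f, z = P.c * w) →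
        ¬ (3 : ℤ) ∣ P.maninConstant →
        ∃ (ι : (n : ℕ) → (CyclotomicField n ℚ →+* ℂ)) (κK : ℝ)
          (Λ : ∀ (k' : ℕ) (r : Finset (HeightOneSpectrum (𝓞 ℚ))),
            H1 (tateRep W 3) (cycSubgroup 3 k' r) →ₗ[ℤ_[3]]
              ℚ_[3] ⊗[ℚ] CyclotomicField (cycLevel 3 k' r) ℚ)
          (Λfin : ∀ j : ℕ, galoisCohomology
            ((W.torsionGaloisModule (((3 : ℕ) : ℤ) ^ j * ((3 : ℕ) : ℤ))).toLocal (Sum.inr v₃)) 1 →+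
              ZMod (3 ^ (j + 1))),
          κK ≠ 0 ∧ (∃ u : ℚ, (u : ℝ) = κK ∧ padicValRat 3 u = 0) ∧
          (∀ j : ℕ, KatoExpStarFiniteLevelAt W 3 j 0 v₃ Λ (Λfin j)) ∧
          ∀ (c d a : ℤ) (A : ℕ), 0 < A → Int.gcd c (6 * 3 * A) = 1 → Int.gcd d (6 * 3 * N) = 1 →
            ∃ (z : ∀ (k' : ℕ) (r : (cyclotomicLevelsRat 3 (badPlaces c d A N)).Ideals),
                  H1 (tateRep W 3) ((cyclotomicLevelsRat 3 (badPlaces c d A N)).level k' r.1))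
              (x : ∀ (k' : ℕ) (r : (cyclotomicLevelsRat 3 (badPlaces c d A N)).Ideals),
                  CyclotomicField (cycLevel 3 k' r.1) ℚ),
              ZetaBody W 3 P.f ι κK Λ c d a A z x)
    (hC3 : ∀ (W : WeierstrassCurve ℚ) [W.IsElliptic] [W.IsGloballyMinimal],
      (∀ m : ℕ, W.HasSurjectiveModNGaloisRep (3 ^ m : ℕ)) →
      (haveI : Fact (Nat.Prime 3) := ⟨Nat.prime_three⟩; Addv W 3) →
      ¬ 3 ∣ (W.baseChange ℚ_[3]).localTamagawaNumber ℤ_[3] →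
      Nat.card {Q : (W.baseChange ℚ_[3]).toAffine.Point // (3 : ℕ) • Q = 0} = 1 →
      ∀ (v₃ : HeightOneSpectrum (𝓞 ℚ)), ((3 : ℕ) : 𝓞 ℚ) ∈ v₃.asIdeal →
      ∀ (η : (q : HeightOneSpectrum (𝓞 ℚ)) → (ZMod (Ideal.absNorm q.asIdeal))ˣ),
        (∀ q, Subgroup.zpowers (η q) = ⊤) →
      ∀ {N : ℕ} [NeZero N] (P : ModularParametrizationData W N), N = W.conductorNorm ℤ →
        (∀ z ∈ P.L.lattice, ∃ w ∈ periodLattice P.f, z = P.c * w) →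
        ¬ (3 : ℤ) ∣ P.maninConstant →
        (∃ w : HeightOneSpectrum (𝓞 ℚ), ¬ W.HasGoodReductionAt w ∧
          ((primesEquiv w : Nat.Primes) : ℕ) ≠ 3 ∧
          ∃ Q : (W.baseChange (w.adicCompletion ℚ)).toAffine.Point, 3 • Q = 0 ∧ Q ≠ 0) →
        KatoKuriharaPortThreeAtWith₂ W 0 v₃ η P)
    (hOff : ShallowEqDeepOffKatoStratum) :
    ShallowEqDeepAtTorsionFree :=
  KimAtThreeDeepLowerSplitGlueItem.shallowEqDeepAtTorsionFree_of_katoStratumSharedParts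
    (katoStratumSharedParts_of_pub_of_fineKato_of_anomalousRows hSak hGZK hPT hlev hC1 hC3) hOff

/-! ### §3. The whole route's residual in one kernel theorem -/
/-- **The leaf `N11.KimAtThreeRankZeroPUB` (rung W2 = Kim arXiv:2505.09121 Thm. 1.1/1.2 at `p = 3`, rank
0, `t = 0`) from four PUBLISHED inputs BY NAME + (C1) + (C3) + crux 19562 `DeepUpperAtThreeOffKatoStratum`
+ the displayed off-stratum residual (R)_off** (w2-c4 g6's seam
`kimAtThreeRankZeroPUB_of_sharedParts_of_deepUpperOff_of_residualOff`, p463239).  So the ROUTE'S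
RESIDUAL reads {(C1), (C3), 19562, (R)_off} — and {(C1), 19562, (R)_off} once the D7-u END discharges
(C3).  Neither 19075, 19077, 19679, 19599 nor the stub 19561 is an input.  Nothing is booked.
[cite: Kim2025RefinedTNC, Thm. 1.1 and Thm. 1.2] [cite: Kim2022StructureSelmer, Thm. 1.9 (6)]
[cite: Sakamoto2024, Thm. 4.4 (p. 926)] [cite: MazurRubin2004, Thm. 5.2.12 (i) and App. A Remark A.5] -/
theorem kimAtThreeRankZeroPUB_of_pub_of_fineKato_of_anomalousRows_of_deepUpperOff_of_residualOff
    (hSak : SakamotoKolyvaginThree) (hGZK : RankEqAnalyticRankLeOne)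
    (hPT : PoitouTateSelmerDuality) (hlev : CarayolLevelEqConductor)
    (hC1 : ∀ (W : WeierstrassCurve ℚ) [W.IsElliptic] [W.IsGloballyMinimal]
      [ContinuousSMul ℤ_[3] (W.tateModule 3)] [Module.Free ℤ_[3] (W.tateModule 3)]
      [Module.Finite ℤ_[3] (W.tateModule 3)],
      (∀ m : ℕ, W.HasSurjectiveModNGaloisRep (3 ^ m : ℕ)) →
      (haveI : Fact (Nat.Prime 3) := ⟨Nat.prime_three⟩; Addv W 3) →
      ¬ 3 ∣ (W.baseChange ℚ_[3]).localTamagawaNumber ℤ_[3] →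
      Nat.card {Q : (W.baseChange ℚ_[3]).toAffine.Point // (3 : ℕ) • Q = 0} = 1 →
      ∀ (v₃ : HeightOneSpectrum (𝓞 ℚ)), ((3 : ℕ) : 𝓞 ℚ) ∈ v₃.asIdeal →
      ∀ {N : ℕ} [NeZero N] (P : ModularParametrizationData W N), N = W.conductorNorm ℤ →
        (∀ z ∈ P.L.lattice, ∃ w ∈ periodLattice P.f, z = P.c * w) →
        ¬ (3 : ℤ) ∣ P.maninConstant →
        ∃ (ι : (n : ℕ) → (CyclotomicField n ℚ →+* ℂ)) (κK : ℝ)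
          (Λ : ∀ (k' : ℕ) (r : Finset (HeightOneSpectrum (𝓞 ℚ))),
            H1 (tateRep W 3) (cycSubgroup 3 k' r) →ₗ[ℤ_[3]]
              ℚ_[3] ⊗[ℚ] CyclotomicField (cycLevel 3 k' r) ℚ)
          (Λfin : ∀ j : ℕ, galoisCohomology
            ((W.torsionGaloisModule (((3 : ℕ) : ℤ) ^ j * ((3 : ℕ) : ℤ))).toLocal (Sum.inr v₃)) 1 →+
              ZMod (3 ^ (j + 1))),
          κK ≠ 0 ∧ (∃ u : ℚ, (u : ℝ) = κK ∧ padicValRat 3 u = 0) ∧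
          (∀ j : ℕ, KatoExpStarFiniteLevelAt W 3 j 0 v₃ Λ (Λfin j)) ∧
          ∀ (c d a : ℤ) (A : ℕ), 0 < A → Int.gcd c (6 * 3 * A) = 1 → Int.gcd d (6 * 3 * N) = 1 →
            ∃ (z : ∀ (k' : ℕ) (r : (cyclotomicLevelsRat 3 (badPlaces c d A N)).Ideals),
                  H1 (tateRep W 3) ((cyclotomicLevelsRat 3 (badPlaces c d A N)).level k' r.1))
              (x : ∀ (k' : ℕ) (r : (cyclotomicLevelsRat 3 (badPlaces c d A N)).Ideals),
                  CyclotomicField (cycLevel 3 k' r.1) ℚ),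
              ZetaBody W 3 P.f ι κK Λ c d a A z x)
    (hC3 : ∀ (W : WeierstrassCurve ℚ) [W.IsElliptic] [W.IsGloballyMinimal],
      (∀ m : ℕ, W.HasSurjectiveModNGaloisRep (3 ^ m : ℕ)) →
      (haveI : Fact (Nat.Prime 3) := ⟨Nat.prime_three⟩; Addv W 3) →
      ¬ 3 ∣ (W.baseChange ℚ_[3]).localTamagawaNumber ℤ_[3] →
      Nat.card {Q : (W.baseChange ℚ_[3]).toAffine.Point // (3 : ℕ) • Q = 0} = 1 →
      ∀ (v₃ : HeightOneSpectrum (𝓞 ℚ)), ((3 : ℕ) : 𝓞 ℚ) ∈ v₃.asIdeal →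
      ∀ (η : (q : HeightOneSpectrum (𝓞 ℚ)) → (ZMod (Ideal.absNorm q.asIdeal))ˣ),
        (∀ q, Subgroup.zpowers (η q) = ⊤) →
      ∀ {N : ℕ} [NeZero N] (P : ModularParametrizationData W N), N = W.conductorNorm ℤ →
        (∀ z ∈ P.L.lattice, ∃ w ∈ periodLattice P.f, z = P.c * w) →
        ¬ (3 : ℤ) ∣ P.maninConstant →
        (∃ w : HeightOneSpectrum (𝓞 ℚ), ¬ W.HasGoodReductionAt w ∧
          ((primesEquiv w : Nat.Primes) : ℕ) ≠ 3 ∧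
          ∃ Q : (W.baseChange (w.adicCompletion ℚ)).toAffine.Point, 3 • Q = 0 ∧ Q ≠ 0) →
        KatoKuriharaPortThreeAtWith₂ W 0 v₃ η P)
    (hU : DeepUpperAtThreeOffKatoStratum)
    (hRoff : ∀ (W₀ : WeierstrassCurve ℚ) [W₀.IsElliptic] [W₀.IsGloballyMinimal],
      (∀ n : ℕ, W₀.HasSurjectiveModNGaloisRep (3 ^ n : ℕ)) →
      Nat.card {Q : (W₀.baseChange ℚ_[3]).toAffine.Point // (3 : ℕ) • Q = 0} = 1 → Finite W₀.sha →
      ∀ {N : ℕ} [NeZero N], N = W₀.conductorNorm ℤ →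
      ∀ (D₀ : ModularParametrizationData W₀ N),
        (∀ z ∈ D₀.L.lattice, ∃ w ∈ periodLattice D₀.f, z = D₀.c * w) →
        (∀ (W₂ : WeierstrassCurve ℚ) [W₂.IsElliptic] (D₂ : ModularParametrizationData W₂ N),
          D₂.f = D₀.f → D₀.modularDegree ≤ D₂.modularDegree) →
        (∀ r : ℚ, ratPlusSymbol D₀.f r ≠ 0 → 0 ≤ padicValRat 3 (ratPlusSymbol D₀.f r)) →
        kuriharaVanishingOrder W₀ 3 D₀.f = 0 →
        ¬ ((haveI : Fact (Nat.Prime 3) := ⟨Nat.prime_three⟩; Addv W₀ 3) ∧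
            ¬ 3 ∣ (W₀.baseChange ℚ_[3]).localTamagawaNumber ℤ_[3] ∧ ¬ (3 : ℤ) ∣ D₀.maninConstant) →
        kuriharaPartial W₀ 3 D₀.f 0 ≤
          (padicValNat 3 (Nat.card (AddCommGroup.primaryComponent W₀.sha 3)) : ℕ∞) +
            kuriharaPartialInfty W₀ 3 D₀.f) :
    N11.KimAtThreeRankZeroPUB :=
  KimAtThreeShallowEqDeepResidualSeam.kimAtThreeRankZeroPUB_of_sharedParts_of_deepUpperOff_of_residualOff
    (katoStratumSharedParts_of_pub_of_fineKato_of_anomalousRows hSak hGZK hPT hlev hC1 hC3) hU hRoff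

end Summit.BirchSwinnertonDyer.BirchSwinnertonDyer.Theorems.KimAtThreeDeepUpperSplitGlueFineKato

end
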